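import Summits.CriticalPhenomena.SAWScalingLimit.Theorems.LeftRightFKG.Negative.PAKitDefs
import Summits.CriticalPhenomena.SAWScalingLimit.Theorems.LeftRightFKG.Negative.CornerCertWeight4
import HarnessLib

/-!
# Negative knowledge on crux `LeftRightFKG`, part 21b: the `C₄` family certificate, chunk 2 of 3 (computational grade)

Crux `stmt-CriticalPhenomena-11232`.  `checkAll_pairs₄_2`: for every ordered pair `(p, q)` of distinct
boundary-adjacent sites of the `4 × 4` box with first site in
columns `x = 1, 2`: `(1,0), (1,3), (2,0), (2,3)` (44 pairs), the checker of
part 14 accepts the certified chord-code enumeration `codes inV₄ 15 p q` with configuration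
`⟨q, [0,3]², N = 15, S = 2^64, depth 6⟩` on the computational window `[200/539, 5/13] ∋ x_c`
(part 10).  One `native_decide` (compiled evaluation, ≈ 150 s; ≈ 42 000 `2 × 2` minors).  The three chunks are
assembled in part 22 (`checkAll_pairs₄`, `weight_pa_C₄`).
Elementary ("folklore") modulo the compiled evaluation.
-/

namespace Summit.CriticalPhenomena.SAWScalingLimit.Theorems.LeftRightFKG.Negative.PAKit

open Literature.Analysis.ValidatedNumerics
open PolyMP (evalR addR mulR smulR posOn)
open PolyCert (realOf minorI)
open Census (censusList census)

/-! ## §11b2 The `C₄` family certificate, chunk 2 (first endpoint in columns `x = 1, 2`) -/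

section Family4Cert2

open Literature.Probability.LatticeModels
open CornerCert (inV₄)

/-- **Family certificate, chunk 2**: first site in columns `x = 1, 2` (44 pairs; ≈ 140 s). [folklore] -/
theorem checkAll_pairs₄_2 :
    ∀ p ∈ [((1 : ℤ), (0 : ℤ)), (1, 3), (2, 0), (2, 3)],
    ∀ q ∈ [((0 : ℤ), (0 : ℤ)), (0, 1), (0, 2), (0, 3), (1, 0), (1, 3), (2, 0), (2, 3), (3, 0), (3, 1), (3, 2), (3, 3)],
    p ≠ q → checkAll ⟨q, 0, 3, 0, 3, 15, 2 ^ 64, 6, 200 / 539, 5 / 13⟩ (codes inV₄ 15 p q) = true := by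
  native_decide

end Family4Cert2

end Summit.CriticalPhenomena.SAWScalingLimit.Theorems.LeftRightFKG.Negative.PAKit
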